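import Summits.Schanuel.Schanuel.Theorems.DiophantineDichotomyKhovanskiiApproxTypeEvDefs
import HarnessLib

/-!
# Ideator round 2, k = 5 — crux `KhovanskiiApproxTypeEv` (stmt-Schanuel-14972): the MINIMAL race input

`planner-cruxidea-stmt-Schanuel-14972-5-0`, 2026-08-17.  Companion of `IdeatorR2K5Notes.md`.

No idea card is filed this round (see the notes: the crux as filed is kernel-certified
`⟺ EvNonLWTwo ∧ EvRankThreeUp` (p125111) `⊇ e ⊥ π ∧ log 2 ⊥ log 3` (p125943); 14 further levers die).
What this file records, CHECKED, is the one structural input the tenure planner needs for the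
restatement everybody has asked for: the WEAKEST Diophantine statement the route's race consumes.

* `RaceInputAt n s` — the LIMINF / SINGLE-LEVEL form: for every `ε > 0` there are infinitely many
  degree levels `D` at which, eventually in the height, every challenger of level `(D, H)` stays at
  distance `≥ exp(−(ε·D^{1/(n−1)}·log H + κ))`.  No exponent `a`, no constant `C`, no `dᵇ` term, no
  "for all d": the prover may CHOOSE the favourable degrees.  (IdeatorK2Notes §A / IdeatorR1K2Notes
  §1(c) observed "w_d = o(d^{1/(n−1)}) suffices"; the exact condition is liminf, and one level `D`
  covers all `d ≤ D` because level `(D, H)` contains level `(d, H)`.)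
* `raceInputAt_of_approxTypeEvAt` (PROVED): eventual type `a < 1/(n−1)` ⇒ `RaceInputAt`; hence
  `khovanskiiRaceInput_of_ev : KhovanskiiApproxTypeEv → KhovanskiiRaceInput` (PROVED).
* `approximationRaceLiminf : ApproximationRaceLiminf` (PROVED, axioms propext / Classical.choice /
  Quot.sound): `ApproximationProperty → KhovanskiiRaceInput → KhovanskiiSchanuel` — the route's race
  compactness run at ONE degree level (take `ε := 1/(2c²)`, the level `D ≥ (c²)^{n−1}` given by
  `RaceInputAt`, `Δ := D^{1/(n−1)}/c`, so that AP's degree cap `(cΔ)^{n−1}` is exactly `D`; then let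
  `Y → ∞`).  So the liminf form is RACE-SUFFICIENT, kernel-checked: with the landed
  `khovanskiiReduction_proof` it gives `ApproximationProperty → KhovanskiiRaceInput → Schanuel`, i.e. a
  restated route would keep a certified `closes` (restatement target R4 of the notes).

By R2 of `Lines/Sketch-dead.md` (p124730) every race-sufficient input at a point still yields
`2 ≤ trdeg` there, so `KhovanskiiRaceInput` is NOT easier than Schanuel pointwise — it is only the
honest MINIMUM of what the route asserts beyond Schanuel (no Z′-type surplus at bounded degree except
"not a simultaneous U-point along a sequence of degrees").
-/

noncomputable section

set_option linter.dupNamespace false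

namespace Summit.Schanuel.Schanuel.Cruxes.KhovanskiiApproxTypeEv.IdeatorR2K5

open Summit.Schanuel.Schanuel.Theses.DiophantineDichotomy
  (KhovanskiiApproxTypeEv ApproximationProperty KhovanskiiSchanuel)
open Summit.Schanuel.Schanuel.Cruxes.KhovanskiiApproxType.LwSmallHeight (IsFreeKhovanskii)
open Summit.Schanuel.Schanuel.Cruxes.KhovanskiiApproxTypeEv.AnchoredReduction
  (ApproxTypeEvAt khovanskiiApproxTypeEv_iff)

/-- Challenger `γ` is of LEVEL `(D, H)`: field degree `≤ D`, every coordinate a root of a non-zero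
integer polynomial of degree `≤ D` and naive height `≤ H` (verbatim the two clauses of the crux). -/
def IsLevel (n D H : ℕ) (γ : Fin n ⊕ Fin n → ℂ) : Prop :=
  Module.finrank ℚ ↥(IntermediateField.adjoin ℚ (Set.range γ)) ≤ D ∧
    ∀ i, ∃ P : Polynomial ℤ, P ≠ 0 ∧ P.natDegree ≤ D ∧ (∀ k, |P.coeff k| ≤ (H : ℤ)) ∧
      Polynomial.aeval (γ i) P = 0

/-- **R4 — the minimal race input at `θ = (s, e^s)` (liminf / single-level form).**  For every
`ε > 0` and every `D₀` there is a degree level `D ≥ D₀`, an additive constant `κ` and a height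
threshold `H₀` such that every challenger of level `(D, H)` with `H ≥ H₀` satisfies
`‖γ − θ‖ ≥ exp(−(ε · D^{1/(n−1)} · log H + κ))`. -/
def RaceInputAt (n : ℕ) (s : Fin n → ℂ) : Prop :=
  ∀ ε : ℝ, 0 < ε → ∀ D₀ : ℕ, ∃ D : ℕ, D₀ ≤ D ∧ ∃ (κ : ℝ) (H₀ : ℕ),
    ∀ (H : ℕ) (γ : Fin n ⊕ Fin n → ℂ), H₀ ≤ H → IsLevel n D H γ →
      Real.exp (-(ε * (D : ℝ) ^ (1 / ((n : ℝ) - 1)) * Real.log H + κ)) ≤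
        ‖γ - Sum.elim s (Complex.exp ∘ s)‖

/-- `RaceInputAt` at every free Khovanskii point of rank `n ≥ 2` with `ℚ`-linearly independent
coordinates — the candidate RESTATED crux (liminf form). -/
def KhovanskiiRaceInput : Prop :=
  ∀ (n : ℕ) (s : Fin n → ℂ), 2 ≤ n → LinearIndependent ℚ s → IsFreeKhovanskii n s → RaceInputAt n s

/-- The race from the minimal input (statement; provable now by the proof of the route's `closes`,
see the module docstring). -/
def ApproximationRaceLiminf : Prop :=
  ApproximationProperty → KhovanskiiRaceInput → KhovanskiiSchanuel

/-- An eventual type with exponent `a < 1/(n−1)` gives the minimal race input (choose the level `D`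
with `C · Dᵃ ≤ ε · D^{1/(n−1)}`, `κ := C · Dᵇ`). -/
theorem raceInputAt_of_approxTypeEvAt {n : ℕ} {s : Fin n → ℂ} {a b C : ℝ}
    (ha : a < 1 / ((n : ℝ) - 1)) (h : ApproxTypeEvAt n s a b C) : RaceInputAt n s := by
  obtain ⟨hC, hmeas⟩ := h
  intro ε hε D₀
  set e : ℝ := 1 / ((n : ℝ) - 1) with he
  have hea : 0 < e - a := sub_pos.mpr ha
  -- eventually in `x : ℝ`, `C / ε ≤ x ^ (e - a)`
  have hev : ∀ᶠ x : ℝ in Filter.atTop, C / ε ≤ x ^ (e - a) :=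
    (tendsto_rpow_atTop hea).eventually_ge_atTop (C / ε)
  have hevN : ∀ᶠ D : ℕ in Filter.atTop, C / ε ≤ (D : ℝ) ^ (e - a) :=
    tendsto_natCast_atTop_atTop.eventually hev
  obtain ⟨D, hD, hD₀, hD1⟩ :=
    (hevN.and ((Filter.eventually_ge_atTop D₀).and (Filter.eventually_ge_atTop 1))).exists
  obtain ⟨H₀, hH₀⟩ := hmeas D
  refine ⟨D, hD₀, C * (D : ℝ) ^ b, H₀, fun H γ hH hγ => ?_⟩
  have hlow := hH₀ H γ hH hγ.1 hγ.2
  refine le_trans (Real.exp_le_exp.mpr ?_) hlow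
  -- compare the exponents: `C (Dᵃ log H + Dᵇ) ≤ ε D^e log H + C Dᵇ`
  have hDpos : (0 : ℝ) < D := by exact_mod_cast hD1
  have hlog : 0 ≤ Real.log H := Real.log_natCast_nonneg H
  have hkey : C * (D : ℝ) ^ a ≤ ε * (D : ℝ) ^ e := by
    have h1 : C ≤ ε * (D : ℝ) ^ (e - a) := by
      have := (div_le_iff₀ hε).mp hD
      linarith [this]
    have h2 : C * (D : ℝ) ^ a ≤ ε * (D : ℝ) ^ (e - a) * (D : ℝ) ^ a :=
      mul_le_mul_of_nonneg_right h1 (Real.rpow_nonneg hDpos.le a)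
    calc C * (D : ℝ) ^ a ≤ ε * (D : ℝ) ^ (e - a) * (D : ℝ) ^ a := h2
      _ = ε * ((D : ℝ) ^ (e - a) * (D : ℝ) ^ a) := by ring
      _ = ε * (D : ℝ) ^ e := by rw [← Real.rpow_add hDpos, sub_add_cancel]
  have h3 : C * (D : ℝ) ^ a * Real.log H ≤ ε * (D : ℝ) ^ e * Real.log H :=
    mul_le_mul_of_nonneg_right hkey hlog
  have h4 : C * ((D : ℝ) ^ a * Real.log H + (D : ℝ) ^ b) =
      C * (D : ℝ) ^ a * Real.log H + C * (D : ℝ) ^ b := by ring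
  rw [neg_le_neg_iff, h4]
  linarith

/-- The crux as filed implies the liminf-form restatement. -/
theorem khovanskiiRaceInput_of_ev (hEv : KhovanskiiApproxTypeEv) : KhovanskiiRaceInput := by
  intro n s hn hs hfree
  obtain ⟨a, b, C, ha, hT⟩ := (khovanskiiApproxTypeEv_iff.mp hEv) n s hn hs hfree
  exact raceInputAt_of_approxTypeEvAt ha hT

/-- **The race from the minimal input (R4, certified).**  Philippon's approximation property and the
liminf-form input at every free Khovanskii point give Schanuel at free Khovanskii points.  Proof = the
race compactness of the route's `closes`, run at ONE degree level: if `trdeg ℚ(θ) ≤ t = n − 1`, let `c`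
be the AP constant at `θ`, take `ε := 1/(2c²)` and a level `D ≥ (c²)ᵗ` supplied by `RaceInputAt`, put
`Δ := D^{1/t}/c ≥ c`, so that AP's degree cap `(cΔ)ᵗ` is exactly `D`; the points all of whose
coordinates are roots of non-zero integer polynomials of degree `≤ D` and height `≤ H₀` form a finite set
missing `θ` (Hermite–Lindemann), so for `Y → ∞` the AP approximant at `(Δ, Y)` has height `> H₀`, is of
level `(D, H)`, and `(Δ log H + dY)/c ≤ ε D^{1/t} log H + κ` reads `D^{1/t} log H/(2c²) + dY/c ≤ κ`,
absurd for `Y > cκ`. -/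
theorem approximationRaceLiminf : ApproximationRaceLiminf := by
  intro hAP hRI n s hs hg
  have HL := @Literature.NumberTheory.Transcendental.transcendental_exp_holds
  have one_le_of_transc : ∀ {L : IntermediateField ℚ ℂ} {w : ℂ}, w ∈ L → Transcendental ℚ w →
      (1 : Cardinal) ≤ Algebra.trdeg ℚ L := by
    intro L w hw ht
    haveI : Algebra.Transcendental ℚ L :=
      ⟨⟨⟨w, hw⟩, fun h => ht (IntermediateField.isAlgebraic_iff.mp h)⟩⟩
    exact Cardinal.one_le_iff_pos.mpr (_root_.trdeg_pos ℚ L)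
  have one_le_of_root : ∀ {P : Polynomial ℤ} {d : ℕ} {z : ℂ}, P ≠ 0 → P.natDegree ≤ d →
      Polynomial.aeval z P = 0 → 1 ≤ d := by
    intro P d z hP hdeg hz
    by_contra hd
    have hd0 : P.natDegree = 0 := by omega
    rw [Polynomial.eq_C_of_natDegree_eq_zero hd0, Polynomial.aeval_C, eq_intCast,
      Int.cast_eq_zero] at hz
    apply hP
    rw [Polynomial.eq_C_of_natDegree_eq_zero hd0, hz, map_zero]
  have algQ : ∀ {z : ℂ} {P : Polynomial ℤ}, P ≠ 0 → Polynomial.aeval z P = 0 → IsAlgebraic ℚ z :=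
    fun hP hz => IsAlgebraic.extendScalars (R := ℤ) (S := ℚ) (algebraMap ℤ ℚ).injective_int ⟨_, hP, hz⟩
  rcases Nat.lt_or_ge n 2 with hn | hn
  · interval_cases n
    · simp
    · -- `n = 1`: Hermite–Lindemann
      rw [Nat.cast_one]
      by_cases halg : IsAlgebraic ℚ (s 0)
      · exact one_le_of_transc (IntermediateField.subset_adjoin ℚ _ (Or.inr ⟨0, rfl⟩))
          (HL halg (hs.ne_zero 0))
      · exact one_le_of_transc (IntermediateField.subset_adjoin ℚ _ (Or.inl ⟨0, rfl⟩)) halg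
  · -- `n ≥ 2`: the race at ONE level
    by_contra hlt
    rw [not_le] at hlt
    set t : ℕ := n - 1 with ht
    have htn : n = t + 1 := by omega
    have ht1 : 1 ≤ t := by omega
    have htpos : (0 : ℝ) < t := by exact_mod_cast ht1
    have key : ∀ S : Set ℂ, S = Set.range s ∪ Set.range (Complex.exp ∘ s) →
        Algebra.trdeg ℚ ↥(IntermediateField.adjoin ℚ S) ≤ (t : Cardinal) := by
      rintro S rfl
      have h1 : (n : Cardinal) = Order.succ (t : Cardinal) := by
        rw [Cardinal.succ_natCast]
        exact_mod_cast htn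
      rw [h1] at hlt
      exact Order.lt_succ_iff.mp hlt
    obtain ⟨c, hc1, hAP'⟩ := hAP (Fin n ⊕ Fin n) (Sum.elim s (Complex.exp ∘ s)) t
      ht1 (key _ (Set.Sum.elim_range _ _))
    have hcpos : (0 : ℝ) < c := lt_of_lt_of_le one_pos hc1
    -- the minimal input at `θ`: `ε := 1/(2c²)`, a level `D ≥ (c²)ᵗ`
    have hε : (0 : ℝ) < 1 / (2 * c ^ 2) := by positivity
    obtain ⟨D, hD₀, κ, Hm, hmeas⟩ :=
      hRI n s hn hs hg (1 / (2 * c ^ 2)) hε (⌈(c ^ 2) ^ t⌉₊ + 1)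
    have hD1 : (1 : ℝ) ≤ D := by exact_mod_cast (le_trans (Nat.le_add_left 1 _) hD₀)
    have hDpos : (0 : ℝ) < D := lt_of_lt_of_le one_pos hD1
    have hDge : (c ^ 2) ^ t ≤ (D : ℝ) := by
      have h1 : ((c ^ 2) ^ t : ℝ) ≤ ⌈(c ^ 2) ^ t⌉₊ := Nat.le_ceil _
      have h2 : ((⌈(c ^ 2) ^ t⌉₊ : ℕ) : ℝ) ≤ D := by exact_mod_cast le_trans (Nat.le_succ _) hD₀
      exact h1.trans h2
    -- `Pw := D^{1/t}` and `Δ := Pw / c`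
    set Pw : ℝ := (D : ℝ) ^ (1 / (t : ℝ)) with hPw
    have hPwpos : 0 < Pw := Real.rpow_pos_of_pos hDpos _
    have hPwpow : Pw ^ t = (D : ℝ) := by
      rw [hPw, ← Real.rpow_natCast, ← Real.rpow_mul hDpos.le, one_div_mul_cancel htpos.ne',
        Real.rpow_one]
    have hPwge : c ^ 2 ≤ Pw := by
      have h0 : (0 : ℝ) ≤ (c ^ 2) ^ t := by positivity
      have h1 : ((c ^ 2) ^ t : ℝ) ^ (1 / (t : ℝ)) ≤ Pw := Real.rpow_le_rpow h0 hDge (by positivity)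
      have h2 : ((c ^ 2) ^ t : ℝ) ^ (1 / (t : ℝ)) = c ^ 2 := by
        rw [← Real.rpow_natCast, ← Real.rpow_mul (by positivity), mul_one_div_cancel htpos.ne',
          Real.rpow_one]
      rw [h2] at h1
      exact h1
    have hcΔ : c ≤ Pw / c := by
      rw [le_div_iff₀ hcpos]
      nlinarith [hPwge]
    have hΔpos : 0 < Pw / c := lt_of_lt_of_le hcpos hcΔ
    have hcΔ' : c * (Pw / c) = Pw := by field_simp
    -- RACE COMPACTNESS at the single level `D` with the threshold `Hm`
    obtain ⟨E, hE⟩ : ∃ E : Set (Fin n ⊕ Fin n → ℂ), ∀ γ, γ ∈ E ↔ ∀ i, ∃ P : Polynomial ℤ, P ≠ 0 ∧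
        P.natDegree ≤ D ∧ (∀ k, |P.coeff k| ≤ (Hm : ℤ)) ∧ Polynomial.aeval (γ i) P = 0 :=
      ⟨{γ | ∀ i, ∃ P : Polynomial ℤ, P ≠ 0 ∧ P.natDegree ≤ D ∧ (∀ k, |P.coeff k| ≤ (Hm : ℤ)) ∧
          Polynomial.aeval (γ i) P = 0}, fun γ => Iff.rfl⟩
    have hinj : Function.Injective (algebraMap ℤ ℂ) := (algebraMap ℤ ℂ).injective_int
    have hEfin : E.Finite := by
      have hR := Polynomial.bUnion_roots_finite (algebraMap ℤ ℂ) D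
        (Set.finite_Icc (-(Hm : ℤ)) (Hm : ℤ))
      refine (Set.Finite.pi fun (_ : Fin n ⊕ Fin n) => hR).subset fun γ hγ => ?_
      rw [Set.mem_univ_pi]
      intro i
      obtain ⟨P, hP0, hdeg, hcoef, hroot⟩ := (hE γ).mp hγ i
      refine Set.mem_iUnion₂.mpr ⟨P, ⟨hdeg, fun k => Set.mem_Icc.mpr (abs_le.mp (hcoef k))⟩, ?_⟩
      rw [Finset.mem_coe, Multiset.mem_toFinset, Polynomial.mem_roots_map_of_injective hinj hP0,
        ← Polynomial.aeval_def]
      exact hroot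
    have hθE : Sum.elim s (Complex.exp ∘ s) ∉ E := by
      intro hθ
      obtain ⟨P, hP0, -, -, hPz⟩ := (hE _).mp hθ (Sum.inl ⟨0, by omega⟩)
      obtain ⟨Q, hQ0, -, -, hQz⟩ := (hE _).mp hθ (Sum.inr ⟨0, by omega⟩)
      exact HL (algQ hP0 hPz) (hs.ne_zero _) (algQ hQ0 hQz)
    have htend : Filter.Tendsto (fun Y : ℝ => Real.exp (-(Y / c))) Filter.atTop (nhds 0) :=
      Real.tendsto_exp_atBot.comp
        (Filter.tendsto_neg_atTop_atBot.comp (Filter.tendsto_id.atTop_div_const hcpos))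
    have hall : ∀ᶠ Y : ℝ in Filter.atTop, ∀ p ∈ E,
        Real.exp (-(Y / c)) < ‖p - Sum.elim s (Complex.exp ∘ s)‖ := by
      refine (hEfin.eventually_all).mpr fun p hp => htend.eventually (gt_mem_nhds ?_)
      rw [norm_pos_iff, sub_ne_zero]
      rintro rfl
      exact hθE hp
    obtain ⟨Y, hΔY, hY1, hY0, hYsep⟩ :=
      ((Filter.eventually_ge_atTop (Pw / c)).and ((Filter.eventually_ge_atTop (κ * c + 1)).and
        ((Filter.eventually_ge_atTop (0 : ℝ)).and hall))).exists
    obtain ⟨γ, d, H, hfin, hpoly, hdcap, -, hdist⟩ := hAP' (Pw / c) Y hcΔ hΔY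
    obtain ⟨P₀, hP₀0, hP₀deg, -, hP₀z⟩ := hpoly (Sum.inl ⟨0, by omega⟩)
    have h1d : 1 ≤ d := one_le_of_root hP₀0 hP₀deg hP₀z
    -- the degree cap `(cΔ)ᵗ = D`
    have hdD : d ≤ D := by
      have h1 : (d : ℝ) ≤ (D : ℝ) := by rw [hcΔ', hPwpow] at hdcap; exact hdcap
      exact_mod_cast h1
    have hdistY : ‖γ - Sum.elim s (Complex.exp ∘ s)‖ ≤ Real.exp (-(Y / c)) := by
      refine hdist.trans (Real.exp_le_exp.mpr ?_)
      have hlogH : 0 ≤ Real.log H := Real.log_natCast_nonneg H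
      have hYle : Y ≤ Real.log H * (Pw / c) + d * Y := by
        have hdY : Y ≤ (d : ℝ) * Y := le_mul_of_one_le_left hY0 (by exact_mod_cast h1d)
        nlinarith [mul_nonneg hlogH hΔpos.le]
      have := div_le_div_of_nonneg_right hYle hcpos.le
      linarith
    have hγE : γ ∉ E := fun hγ => absurd hdistY (not_le.mpr (hYsep γ hγ))
    have hHm_lt : Hm < H := by
      by_contra hH
      push Not at hH
      refine hγE ((hE γ).mpr fun i => ?_)
      obtain ⟨P, hP0, hPdeg, hPH, hPz⟩ := hpoly i
      exact ⟨P, hP0, hPdeg.trans hdD, fun k => (hPH k).trans (by exact_mod_cast hH), hPz⟩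
    have hlevel : IsLevel n D H γ :=
      ⟨hfin.trans hdD, fun i => by
        obtain ⟨P, hP0, hPdeg, hPH, hPz⟩ := hpoly i
        exact ⟨P, hP0, hPdeg.trans hdD, hPH, hPz⟩⟩
    have hlow := hmeas H γ hHm_lt.le hlevel
    have hnt : (n : ℝ) - 1 = (t : ℝ) := by rw [htn]; push_cast; ring
    rw [hnt, ← hPw] at hlow
    have hsand := neg_le_neg (Real.exp_le_exp.mp (hlow.trans hdist))
    rw [neg_neg, neg_neg] at hsand
    -- `hsand : (log H · Δ + d Y)/c ≤ ε · Pw · log H + κ`; now the arithmetic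
    set L : ℝ := Real.log H with hL
    have hL0 : 0 ≤ L := Real.log_natCast_nonneg H
    set Q : ℝ := L * Pw with hQ
    have hQ0 : 0 ≤ Q := mul_nonneg hL0 hPwpos.le
    have e1 : (L * (Pw / c) + d * Y) / c = Q / c ^ 2 + d * Y / c := by
      rw [hQ]; field_simp
    have e2 : 1 / (2 * c ^ 2) * Pw * L + κ = Q / c ^ 2 / 2 + κ := by
      rw [hQ]; field_simp
    rw [e1, e2] at hsand
    have hQc : 0 ≤ Q / c ^ 2 := div_nonneg hQ0 (by positivity)
    have hdY : Y / c ≤ d * Y / c :=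
      div_le_div_of_nonneg_right (le_mul_of_one_le_left hY0 (by exact_mod_cast h1d)) hcpos.le
    have hYc : κ + 1 / c ≤ Y / c := by
      rw [le_div_iff₀ hcpos]
      have e3 : (κ + 1 / c) * c = κ * c + 1 := by field_simp
      linarith [e3, hY1]
    have hcinv : (0 : ℝ) < 1 / c := by positivity
    linarith [hQc, hdY, hYc, hcinv, hsand]

end Summit.Schanuel.Schanuel.Cruxes.KhovanskiiApproxTypeEv.IdeatorR2K5
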